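import Literature.NumberTheory.DiophantineGeometry.SmoothProperModelBirationalGroupLawCoreChart
import Literature.NumberTheory.DiophantineGeometry.SmoothProperModelRelJacobianUnit
import Literature.AlgebraicGeometry.Motives.GenericFibreIsoPack
import Literature.AlgebraicGeometry.Motives.ShearCocycleIdentity
import Literature.AlgebraicGeometry.Motives.ShearCocycleResidueAtSlice
import Literature.AlgebraicGeometry.Motives.SmoothProperModelTopFormFrame
import Literature.AlgebraicGeometry.Motives.FunctionFieldProductRelativeBasis
import Literature.AlgebraicGeometry.Motives.AlgebraicEquivalencePushforwardFacts
import Literature.AlgebraicGeometry.Smoothening.ChartUniformizerPrime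
import Literature.AlgebraicGeometry.Morphisms.SpecialFibreProjectionsSpecialize
import Literature.NumberTheory.EllipticCurves.NeronModelAbelianSchemeProofs
import Mathlib.AlgebraicGeometry.Geometrically.Irreducible
import HarnessLib

/-!
# The étale heart of the group law on a smooth proper model (core of (W0))

Topic `Literature/NumberTheory/DiophantineGeometry` (proofs only; no definitions, no named facts).

Let `R` be a discrete valuation ring with fraction field `K`, `𝒳 → Spec R` smooth, proper, with
geometrically irreducible fibres, `E = 𝒳_K` a group scheme over `K` (through `e : 𝒳_K ≅ E`), and
`(D, m)` an `R`-morphism `m : D → 𝒳` on an open `D ⊆ 𝒳 ×_R 𝒳` containing the generic fibre and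
extending the multiplication of `E` there (`hgen`).  Put `Φ = (pr₁, m) : D → 𝒳 ×_R 𝒳` and let `ξ`
be a point of `D` in the special fibre which specializes to every point of the special fibre (the
generic point of the special fibre of `𝒳 ×_R 𝒳`, ★ `Morphisms.exists_generic_specialFibre`).

* `core_fst` — **if `Φ` is an isomorphism over the generic fibre, then `Φ` is flat and locally of
  finite presentation on an open neighbourhood `V ⊆ D` of `ξ`.**

This is the step «`φ` is étale at the points of `W`» of Bosch–Lütkebohmert–Raynaud, *Néron Models*
§4.3 Prop. 6 / Edixhoven–Romagny Thm. 6.3 (with étale weakened to flat + lfp, which is what the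
(W0) assembly `SmoothProperModelBirationalGroupLaw` consumes), proved by the `ω`-ARGUMENT read on the
model: S1 a chart `V ∋ γ = m(ξ)` of `𝒳` with an exact basis `d yᵢ` of `Ω[Γ(V)⁄R]`
(★ `Smoothening.exists_affineChart_basis_eq_D`); S2 `prᵢ ξ ∈ V`
(★ `Morphisms.fst_specializes_and_snd_specializes_of_specialFibre`); S3 the product chart
`c : Spec (Γ(V) ⊗_R Γ(V)) → 𝒳 ×_R 𝒳` (★ `Motives.exists_productChart`); S4 a basic open
`Spec C`, `C = (Γ(V) ⊗_R Γ(V))_h`, through `ξ` inside `c⁻¹(D ∩ m⁻¹ V)`; S5 the ring map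
`m♯ : Γ(V) → C` of `m` on `Spec C` (`IsOpenImmersion.lift`, `Spec.preimage`); S7 the relative
Jacobian `det (∂ m♯ yᵢ / ∂ (1 ⊗ yⱼ))` is a UNIT of `C` (★ `isUnit_det_relJacobian`: the invariant
top form of `E` read on `𝒳` ★ `exists_topForm_frame_genericFibre_of_grpObj`, the relative basis
★ `exists_basis_kaehler_functionField_tensorObj`, the action `σ` of `Φ` on `K(𝒳 ×_R 𝒳)`
★ `GenericFibreIsoPack`, and the shear identity `Φ^*(pr₂^* θ) = pr₂^* θ`
★ `shear_identity_of_residue_eq_one`, its residue input at `(ε, ε)`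
★ `exists_germ_shearCocycle_residue_eq_one_unitPoint`); S6+S8+S9 the Jacobian
criterion on the chart and the transfer to `𝒳 ×_R 𝒳`
(★ `flat_and_locallyOfFinitePresentation_lift_of_isUnit_det`).
Cell `hodgecm-mathlib`, road W of `r₀` (B-p18 (W0) lead; leaves by B-p01, B-p03, B-p07, B-p09,
B-p12, B-p13, B-p20, B-p21, A-p04).

## Sources

* S. Bosch, W. Lütkebohmert, M. Raynaud, *Néron Models*, Ergebnisse 21, Springer 1990, §4.3
  Prop. 6 (and its proof), §4.2 Prop. 1–2, §2.2 Prop. 11. [BLRNeronModels1990]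
* B. Edixhoven, M. Romagny, *Group schemes out of birational group laws, Néron models*, in
  *Autour des schémas en groupes*, Panoramas et Synthèses 47 (2016), Thm. 6.3. [EdixhovenRomagny2012]
-/

noncomputable section

universe u

namespace Literature.NumberTheory.DiophantineGeometry.SmoothProperModelBirationalGroupLawCore

open CategoryTheory Limits _root_.AlgebraicGeometry MonoidalCategory CartesianMonoidalCategory
open Literature.NumberTheory.EllipticCurves Literature.AlgebraicGeometry.Motives
open Literature.AlgebraicGeometry.Motives.RatFn Literature.AlgebraicGeometry.Smoothening
open TensorProduct
open scoped MonObj CategoryTheory.Obj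

variable (R : Type u) [CommRing R] [IsDomain R] [IsDiscreteValuationRing R]
  (K : Type u) [Field K] [Algebra R K] [IsFractionRing R K]

variable [IsOpenImmersion (specGenericPoint R K)]

variable (𝒳 : Over (Spec (.of R))) [Smooth 𝒳.hom] [IsProper 𝒳.hom] [GeometricallyIrreducible 𝒳.hom]

/-! ### The core -/

/-- **`core_fst`** — the étale heart of (W0) (Bosch–Lütkebohmert–Raynaud §4.3 Prop. 6 /
Edixhoven–Romagny Thm. 6.3): for the datum `(D, m)` extending the multiplication of `E` over the
generic fibre (`hgen`), `Φ = (pr₁, m)` an isomorphism over the generic fibre (`hΦiso`), and a point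
`ξ` of `D` in the special fibre specializing to every point of the special fibre (`hξgen`), the
morphism `Φ = (pr₁, m)` is flat and locally of finite presentation on an open `V ∋ ξ`, `V ⊆ D`.
S1 ★ C1 chart at `γ = m ξ`; S2 ★ X1; S3 ★ product chart; S4 basic open inside `D ∩ m⁻¹ V`;
S5 the ring map `m♯`; S6+S8+S9 ★ chart theorem; S7 the relative Jacobian is a unit (★ L4a′,
★ C5′, ★ ISO-PACK, L4c′, S7). [cite: BLRNeronModels1990, §4.3 Prop. 6]
[cite: EdixhovenRomagny2012, Thm. 6.3] -/
theorem core_fst (n : ℕ) [SmoothOfRelativeDimension n 𝒳.hom] [IsIntegral 𝒳.left]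
    [IsIntegral (𝒳 ⊗ 𝒳).left]
    (E : Over (Spec (.of K))) [GrpObj E] (e : (genericFibre R K).obj 𝒳 ≅ E)
    (D : (𝒳 ⊗ 𝒳).left.Opens) (hD : (𝒳 ⊗ 𝒳).hom ⁻¹ᵁ (specGenericPoint R K).opensRange ≤ D)
    (m : (D : Scheme.{u}) ⟶ 𝒳.left) (hm : m ≫ 𝒳.hom = D.ι ≫ (𝒳 ⊗ 𝒳).hom)
    (hgen : (𝒳 ⊗ 𝒳).left.homOfLE hD ≫ m =
      (IsOpenImmersion.isoOfRangeEq (pullback.fst (𝒳 ⊗ 𝒳).hom (specGenericPoint R K))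
          ((𝒳 ⊗ 𝒳).hom ⁻¹ᵁ (specGenericPoint R K).opensRange).ι (by
            rw [Scheme.Opens.range_ι]
            exact IsOpenImmersion.range_pullbackFst (specGenericPoint R K) (𝒳 ⊗ 𝒳).hom)).inv ≫
        (Functor.OplaxMonoidal.δ (genericFibre R K) 𝒳 𝒳 ≫ (e.hom ⊗ₘ e.hom) ≫ μ[E] ≫ e.inv).left ≫
        pullback.fst 𝒳.hom (specGenericPoint R K))
    (ξ : (𝒳 ⊗ 𝒳).left) (hξD : ξ ∈ D) (hξs : (𝒳 ⊗ 𝒳).hom.base ξ = IsLocalRing.closedPoint R)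
    (_hξ1 : ringKrullDim ((𝒳 ⊗ 𝒳).left.presheaf.stalk ξ) ≤ 1)
    (hξgen : ∀ y : (𝒳 ⊗ 𝒳).left, (𝒳 ⊗ 𝒳).hom.base y = IsLocalRing.closedPoint R → ξ ⤳ y)
    (hΦiso : IsIso (pullback.lift (D.ι ≫ (fst 𝒳 𝒳).left) m
      (by rw [Category.assoc, Over.w (fst 𝒳 𝒳), hm]) ∣_
        ((𝒳 ⊗ 𝒳).hom ⁻¹ᵁ (specGenericPoint R K).opensRange))) :
    ∃ (V : (𝒳 ⊗ 𝒳).left.Opens) (hVD : V ≤ D), ξ ∈ V ∧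
      Flat (pullback.lift (V.ι ≫ (fst 𝒳 𝒳).left) ((𝒳 ⊗ 𝒳).left.homOfLE hVD ≫ m)
        (by rw [Category.assoc, Over.w (fst 𝒳 𝒳), Category.assoc, hm, ← Category.assoc,
              Scheme.homOfLE_ι]) :
        (V : Scheme.{u}) ⟶ pullback 𝒳.hom 𝒳.hom) ∧
      LocallyOfFinitePresentation (pullback.lift (V.ι ≫ (fst 𝒳 𝒳).left)
        ((𝒳 ⊗ 𝒳).left.homOfLE hVD ≫ m)
        (by rw [Category.assoc, Over.w (fst 𝒳 𝒳), Category.assoc, hm, ← Category.assoc,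
              Scheme.homOfLE_ι])) := by
  classical
  -- ### S1: the chart at `γ = m ξ`
  let γ : 𝒳.left := m.base ⟨ξ, hξD⟩
  have hγs : 𝒳.hom.base γ = IsLocalRing.closedPoint R := by
    change (m ≫ 𝒳.hom).base ⟨ξ, hξD⟩ = _
    rw [hm]
    exact hξs
  obtain ⟨V, hV, hγV, y, bV, hbV⟩ :=
    Literature.AlgebraicGeometry.Smoothening.exists_affineChart_basis_eq_D 𝒳.hom n γ
  letI algV : Algebra R Γ(𝒳.left, V) :=
    ((Scheme.ΓSpecIso (.of R)).inv ≫ 𝒳.hom.appLE ⊤ V le_top).hom.toAlgebra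
  -- ### S2: `pr₁ ξ, pr₂ ξ ∈ V`
  obtain ⟨h₁, h₂⟩ :=
    Literature.AlgebraicGeometry.Morphisms.fst_specializes_and_snd_specializes_of_specialFibre
      𝒳 ξ hξs hξgen γ hγs
  have hξ₁ : (fst 𝒳 𝒳).left.base ξ ∈ V := h₁.mem_open V.isOpen hγV
  have hξ₂ : (snd 𝒳 𝒳).left.base ξ ∈ V := h₂.mem_open V.isOpen hγV
  have hx : 𝒳.hom.base ((snd 𝒳 𝒳).left.base ξ) = IsLocalRing.closedPoint R := by
    rw [← Scheme.Hom.comp_apply, Over.w (snd 𝒳 𝒳)]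
    exact hξs
  -- ### S3: the product chart
  obtain ⟨c, hc, hrange, hc₁, hc₂⟩ := exists_productChart 𝒳 𝒳 hV hV rfl rfl
  obtain ⟨t₀, ht₀⟩ : ξ ∈ Set.range c := by
    rw [hrange]; exact ⟨hξ₁, hξ₂⟩
  -- ### S4: a basic open `D(h) ∋ t₀` inside `c⁻¹ (D ∩ m⁻¹ V)`
  let O : (Spec (.of (Γ(𝒳.left, V) ⊗[R] Γ(𝒳.left, V)))).Opens := c ⁻¹ᵁ (D.ι ''ᵁ (m ⁻¹ᵁ V))
  have ht₀O : t₀ ∈ O := by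
    change c.base t₀ ∈ (D.ι ''ᵁ (m ⁻¹ᵁ V) : Set _)
    rw [Scheme.Hom.coe_image, ht₀]
    exact ⟨⟨ξ, hξD⟩, hγV, rfl⟩
  obtain ⟨_, ⟨_, ⟨h, rfl⟩, rfl⟩, ht₀h, hhO⟩ :=
    PrimeSpectrum.isBasis_basic_opens.exists_subset_of_mem_open ht₀O O.isOpen
  let lh : Spec (.of (Localization.Away h)) ⟶ Spec (.of (Γ(𝒳.left, V) ⊗[R] Γ(𝒳.left, V))) :=
    Spec.map (CommRingCat.ofHom (algebraMap _ (Localization.Away h)))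
  let cC : Spec (.of (Localization.Away h)) ⟶ (𝒳 ⊗ 𝒳).left := lh ≫ c
  haveI : IsOpenImmersion cC := inferInstanceAs (IsOpenImmersion (Spec.map _ ≫ c))
  let W : (𝒳 ⊗ 𝒳).left.Opens := cC.opensRange
  have hmemW : ∀ t, t ∈ PrimeSpectrum.basicOpen h → c.base t ∈ W := by
    intro t ht
    have ht' : t ∈ lh.opensRange :=
      (Scheme.Hom.opensRange_localizationAway
        (R := CommRingCat.of (Γ(𝒳.left, V) ⊗[R] Γ(𝒳.left, V))) h).ge ht
    obtain ⟨s, rfl⟩ := ht'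
    exact ⟨s, by simp only [cC, Scheme.Hom.comp_apply]⟩
  have hWsub : ∀ z ∈ W, ∃ t ∈ PrimeSpectrum.basicOpen h, c.base t = z := by
    rintro z ⟨s, rfl⟩
    refine ⟨lh.base s, ?_, (Scheme.Hom.comp_apply _ _ _).symm⟩
    have hs : lh.base s ∈ lh.opensRange := ⟨s, rfl⟩
    exact (Scheme.Hom.opensRange_localizationAway
      (R := CommRingCat.of (Γ(𝒳.left, V) ⊗[R] Γ(𝒳.left, V))) h).le hs
  -- every point of `W` is `D.ι d` for a (unique) `d ∈ m⁻¹ V`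
  have hWO : ∀ z ∈ W, ∃ d : (D : Scheme.{u}), d ∈ m ⁻¹ᵁ V ∧ D.ι.base d = z := by
    intro z hz
    obtain ⟨t, ht, rfl⟩ := hWsub z hz
    have htO : t ∈ O := hhO ht
    change c.base t ∈ (D.ι ''ᵁ (m ⁻¹ᵁ V) : Set _) at htO
    rw [Scheme.Hom.coe_image] at htO
    obtain ⟨d, hd, hd'⟩ := htO
    exact ⟨d, hd, hd'⟩
  have hWD : W ≤ D := by
    intro z hz
    obtain ⟨d, -, rfl⟩ := hWO z hz
    exact d.2
  have hξW : ξ ∈ W := by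
    rw [← ht₀]
    exact hmemW t₀ ht₀h
  -- ### S5: `ℓ : Spec C → D` and the ring map `m♯ : Γ(V) → C` of `ℓ ≫ m : Spec C → V`
  let ℓ : Spec (.of (Localization.Away h)) ⟶ D := cC.isoOpensRange.hom ≫ (𝒳 ⊗ 𝒳).left.homOfLE hWD
  have hℓ : ℓ ≫ D.ι = lh ≫ c := by
    change (cC.isoOpensRange.hom ≫ (𝒳 ⊗ 𝒳).left.homOfLE hWD) ≫ D.ι = cC
    rw [Category.assoc, Scheme.homOfLE_ι, Scheme.Hom.isoOpensRange_hom_ι]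
  have hℓV : Set.range (ℓ ≫ m).base ⊆ Set.range V.ι.base := by
    rintro _ ⟨t, rfl⟩
    rw [Scheme.Opens.range_ι]
    have hz : (ℓ ≫ D.ι).base t ∈ W := by
      rw [hℓ]
      exact ⟨t, rfl⟩
    obtain ⟨d, hd, hd'⟩ := hWO _ hz
    have hdt : d = ℓ.base t := D.ι.isOpenEmbedding.injective (by
      rw [hd']; rfl)
    rw [Scheme.Hom.comp_apply, ← hdt]
    exact hd
  let g : Spec (.of (Localization.Away h)) ⟶ V := IsOpenImmersion.lift V.ι (ℓ ≫ m) hℓV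
  have hg : g ≫ V.ι = ℓ ≫ m := IsOpenImmersion.lift_fac _ _ _
  let ms : Γ(𝒳.left, V) →+* Localization.Away h := (Spec.preimage (g ≫ hV.isoSpec.hom)).hom
  have hms : Spec.map (CommRingCat.ofHom ms) ≫ hV.fromSpec = ℓ ≫ m := by
    change Spec.map (Spec.preimage (g ≫ hV.isoSpec.hom)) ≫ hV.fromSpec = ℓ ≫ m
    rw [Spec.map_preimage, Category.assoc, IsAffineOpen.isoSpec_hom_fromSpec, hg]
  -- ### S6+S8+S9 inputs: the chart `Spec Γ(V) → 𝒳` is `Spec` of a smooth `R`-algebra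
  haveI : Algebra.Smooth R Γ(𝒳.left, V) := algebra_smooth_sections_of_isAffineOpen 𝒳.hom hV rfl
  have hχ : hV.fromSpec ≫ 𝒳.hom = Spec.map (CommRingCat.ofHom (algebraMap R Γ(𝒳.left, V))) :=
    fromSpec_comp_hom_eq_SpecMap_algebraMap (E := 𝒳) hV rfl
  -- ### S7 inputs (a): dominance of the projections, the function-field algebra structures
  haveI : Flat (fst 𝒳 𝒳).left := inferInstanceAs (Flat (pullback.fst 𝒳.hom 𝒳.hom))
  haveI : Flat (snd 𝒳 𝒳).left := inferInstanceAs (Flat (pullback.snd 𝒳.hom 𝒳.hom))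
  haveI : IsDominant (fst 𝒳 𝒳).left := isDominant_of_flat _
  haveI : IsDominant (snd 𝒳 𝒳).left := isDominant_of_flat _
  letI algL : Algebra R 𝒳.left.functionField := (stalkHom 𝒳 (genericPoint 𝒳.left)).toAlgebra
  have hRL : algebraMap R 𝒳.left.functionField = stalkHom 𝒳 (genericPoint 𝒳.left) := rfl
  letI algLM : Algebra 𝒳.left.functionField (𝒳 ⊗ 𝒳).left.functionField :=
    (functionFieldMap (fst 𝒳 𝒳).left).toAlgebra
  have hLM : algebraMap 𝒳.left.functionField (𝒳 ⊗ 𝒳).left.functionField =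
      functionFieldMap (fst 𝒳 𝒳).left := rfl
  -- ### S7 inputs (b): the invariant top form (★ L4a′) and the relative basis (★ C5′)
  obtain ⟨f₀, y₀, B₀, hB₀, hθ⟩ := exists_topForm_frame_genericFibre_of_grpObj R K 𝒳 n E e hRL
  obtain ⟨B₂, hB₂⟩ := exists_basis_kaehler_functionField_tensorObj 𝒳 n hRL hLM B₀ hB₀
  -- ### S7 inputs (c): the shear `Φ_D = (pr₁, m)` and its action `σ` on `K(𝒳 ⊗ 𝒳)` (★ ISO-PACK)
  let ΦD : (D : Scheme.{u}) ⟶ (𝒳 ⊗ 𝒳).left :=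
    pullback.lift (D.ι ≫ (fst 𝒳 𝒳).left) m (by rw [Category.assoc, Over.w (fst 𝒳 𝒳), hm])
  have hΦ₁ : ΦD ≫ (fst 𝒳 𝒳).left = D.ι ≫ (fst 𝒳 𝒳).left := pullback.lift_fst _ _ _
  have hΦ₂ : ΦD ≫ (snd 𝒳 𝒳).left = m := pullback.lift_snd _ _ _
  have hover : ΦD ≫ (𝒳 ⊗ 𝒳).hom = D.ι ≫ (𝒳 ⊗ 𝒳).hom := by
    rw [← Over.w (fst 𝒳 𝒳), ← Category.assoc, hΦ₁, Category.assoc]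
  have hΦU : ΦD ⁻¹ᵁ ((𝒳 ⊗ 𝒳).hom ⁻¹ᵁ (specGenericPoint R K).opensRange) =
      D.ι ⁻¹ᵁ ((𝒳 ⊗ 𝒳).hom ⁻¹ᵁ (specGenericPoint R K).opensRange) :=
    preimage_eq_preimage_ι_of_comp_eq ΦD (𝒳 ⊗ 𝒳).hom (specGenericPoint R K).opensRange hover
  haveI : IsIso (ΦD ∣_ ((𝒳 ⊗ 𝒳).hom ⁻¹ᵁ (specGenericPoint R K).opensRange)) := hΦiso
  have hηU : genericPoint (𝒳 ⊗ 𝒳).left ∈ (𝒳 ⊗ 𝒳).hom ⁻¹ᵁ (specGenericPoint R K).opensRange := by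
    haveI : Smooth (𝒳 ⊗ 𝒳).hom := smooth_tensorObj_hom_of_smooth ‹_› ‹_›
    exact genericPoint_mem_of_preimage_subset (K := K) (𝒳 := 𝒳 ⊗ 𝒳) (fun z hz => hz)
  haveI : Nonempty ((𝒳 ⊗ 𝒳).hom ⁻¹ᵁ (specGenericPoint R K).opensRange) :=
    ⟨⟨genericPoint (𝒳 ⊗ 𝒳).left, hηU⟩⟩
  haveI : Nonempty D := ⟨⟨genericPoint (𝒳 ⊗ 𝒳).left, hD hηU⟩⟩
  haveI : IsDominant D.ι := isDominant_ι_of_le hD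
  haveI : IsDominant ΦD :=
    isDominant_of_isIso_morphismRestrict (U₀ := (𝒳 ⊗ 𝒳).hom ⁻¹ᵁ (specGenericPoint R K).opensRange) ΦD
  obtain ⟨σ, hσ, -⟩ := exists_functionField_endomorphism_of_isIso_morphismRestrict hD ΦD hΦU
  have hisoSt : ∀ qD : ↥(D : Scheme.{u}),
      (𝒳 ⊗ 𝒳).hom.base (D.ι.base qD) ∈ Set.range (specGenericPoint R K).base →
        IsIso (ΦD.stalkMap qD) :=
    fun qD hq => isIso_stalkMap_of_mem ΦD hΦU qD hq
  -- ### S7: the shear identity (L4c′: residue at `(ε, ε)` + constancy) and the unit (S7)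
  have hpin := exists_germ_shearCocycle_residue_eq_one_unitPoint K 𝒳 n hRL hLM E e D hD m hgen
    ΦD hΦ₁ hΦ₂ hisoSt σ hσ f₀ y₀ B₀ hB₀ hθ B₂ hB₂
  have hcocy := shear_identity_of_residue_eq_one 𝒳 E e n hRL hLM D hD ΦD hΦ₁ hisoSt σ hσ
    f₀ y₀ B₀ hB₀ hθ B₂ hB₂ hpin
  -- `σ` is `R`-linear: both `σ` and `1` become `stalkHom D` after the injective `(D ↪ Y)♯`
  have hσR : σ.comp (stalkHom (𝒳 ⊗ 𝒳) (genericPoint (𝒳 ⊗ 𝒳).left)) =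
      stalkHom (𝒳 ⊗ 𝒳) (genericPoint (𝒳 ⊗ 𝒳).left) := by
    let 𝒟 : Over (Spec (.of R)) := Over.mk (D.ι ≫ (𝒳 ⊗ 𝒳).hom)
    let ιO : 𝒟 ⟶ 𝒳 ⊗ 𝒳 := Over.homMk D.ι rfl
    let ΦO : 𝒟 ⟶ 𝒳 ⊗ 𝒳 := Over.homMk ΦD hover
    haveI : IsIntegral 𝒟.left := inferInstanceAs (IsIntegral (D : Scheme.{u}))
    haveI : IsDominant ιO.left := inferInstanceAs (IsDominant D.ι)
    haveI : IsDominant ΦO.left := inferInstanceAs (IsDominant ΦD)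
    have h1 : (functionFieldMap D.ι).comp (stalkHom (𝒳 ⊗ 𝒳) (genericPoint (𝒳 ⊗ 𝒳).left)) =
        stalkHom 𝒟 (genericPoint 𝒟.left) := functionFieldMap_comp_stalkHom ιO
    have h2 : (functionFieldMap ΦD).comp (stalkHom (𝒳 ⊗ 𝒳) (genericPoint (𝒳 ⊗ 𝒳).left)) =
        stalkHom 𝒟 (genericPoint 𝒟.left) := functionFieldMap_comp_stalkHom ΦO
    refine (RingHom.cancel_left (functionFieldMap D.ι).injective).mp ?_
    rw [← RingHom.comp_assoc, hσ, h2, h1]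
  have hΔ := isUnit_det_relJacobian R K 𝒳 n hRL hLM f₀ y₀ B₀ hB₀ hθ D m ΦD hΦ₂ σ hσ hσR B₂ hB₂ hcocy
    hV ((snd 𝒳 𝒳).left.base ξ) hξ₂ hx y bV hbV c hc₁ hc₂ h ℓ hℓ ms hms
  -- ### S6+S8+S9: the chart theorem
  obtain ⟨hflat, hlfp⟩ :=
    flat_and_locallyOfFinitePresentation_lift_of_isUnit_det 𝒳 n Γ(𝒳.left, V) Γ(𝒳.left, V)
      hV.fromSpec hV.fromSpec hχ hχ D m hm y bV hbV c hc₁ hc₂ h W rfl hWD ℓ hℓ ms hms hΔ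
  exact ⟨W, hWD, hξW, hflat, hlfp⟩

end Literature.NumberTheory.DiophantineGeometry.SmoothProperModelBirationalGroupLawCore

end
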